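import Literature.NumberTheory.Automorphic.ShimuraCurveFiniteVolume
import Mathlib.Topology.ContinuousMap.Bounded.ArzelaAscoli
import Mathlib.Analysis.Normed.Module.FiniteDimension
import Mathlib.Analysis.Complex.UpperHalfPlane.Manifold
import Mathlib.Analysis.Complex.Liouville
import HarnessLib

/-!
# `S₂^D(M)` is finite-dimensional for `D > 1`: holomorphic forms of any weight for a cocompact
# group form a finite-dimensional space

A proofs-only companion (theorems only: no definition, no named fact, nothing restated; D-0026) of
`ShimuraCurve.lean`, written by the seat of the named fact
`Literature.NumberTheory.Automorphic.nonempty_shimuraParametrizationData` (Pasten 2024, §2 p. 12).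
Pasten §4.6 p. 15: for the (compact, `D > 1`) curves `X_{U,a}^{an} = Γ̃_{U,a}∖𝔥` the pull-back
`Ψ_{U,a} : H⁰(X^{an}_{U,a}, Ω¹) → S_{U,a}` is an isomorphism, "In particular `dim S_{U,a} = g_U`".
The tree has no Riemann surfaces; this file proves the qualitative statement that underlies the
Hecke-module theory of `S₂^D(M)` (§4.9: decomposition into systems of eigenvalues, multiplicity
one) — **finite-dimensionality** — directly from compactness, for every weight:

* `norm_sq_mul_im_zpow_smul` — for `f` slash-invariant of weight `k` under `Γ ≤ SL₂(ℝ)`,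
  `z ↦ ‖f z‖² (Im z)^k` is `Γ`-invariant (`f(γz) = (cz+d)^k f(z)`, `Im γz = Im z/|cz+d|²`);
* `norm_sq_mul_im_zpow_le_of_cover` — if a compact `K` meets every `Γ`-orbit, then
  `‖f z‖² (Im z)^k ≤ A_K · sup_K ‖f‖²` on all of `ℍ`;
* `finiteDimensional_of_slashInvariant_of_isCompact_cover` — **Riesz–Montel**: a `ℂ`-vector
  space `V` of holomorphic, weight-`k` `Γ`-invariant functions on `ℍ` (an injective linear
  `ι : V → (ℍ → ℂ)`), `Γ ≤ SL₂(ℝ)` admitting a compact `K ⊆ ℍ` with `Γ K = ℍ`, is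
  finite-dimensional. Proof: restriction to `K` is an injective linear map `Φ : V → C(K, ℂ)` (a
  form vanishing on `K` vanishes, by the bound above); the image of `{‖Φ v‖ ≤ 1}` takes values in
  the unit disc and is equicontinuous — by the bound above such `v` are uniformly bounded on a
  uniform complex neighbourhood of `K`, so Cauchy's estimate
  (`Complex.norm_deriv_le_of_forall_mem_sphere_norm_le`) bounds their derivatives near `K` and the
  mean value inequality makes them uniformly Lipschitz there; by Arzelà–Ascoli
  (`BoundedContinuousFunction.arzela_ascoli`) it is relatively compact, so the unit ball of
  `range Φ` is totally bounded and `range Φ ≅ V` is finite-dimensional (Riesz,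
  `FiniteDimensional.of_totallyBounded_nhds_zero`);
* `finiteDimensional_modularForm_of_isCompact_cover`, `finiteDimensional_cuspForm_of_isCompact_cover`
  — for Mathlib's `ModularForm Γ k`, `CuspForm Γ k`;
* `ShimuraCurveData.finiteDimensional_cuspForm`, `ShimuraCurveData.finiteDimensional_modularForm`
  — **`S_k(Γ₀^D(M))` and `M_k(Γ₀^D(M))` are finite-dimensional for `D > 1`** (the tree's
  cocompactness `exists_forall_exists_smul_mem_closedBall`, Vignéras IV Thm. 1.1, and Mathlib's
  `ProperSpace ℍ`).

Classical statement: Shimura 1971, Thm. 2.23 ff. / Miyake Thm. 2.5.2 (dimension of spaces of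
automorphic forms for Fuchsian groups of the first kind, via Riemann–Roch); the compactness proof
given here is the standard normal-families argument (e.g. Freitag–Busam, *Complex Analysis*, VI.1,
finite-dimensionality of `[Γ, k]` via Montel). No dimension formula is claimed.

## References

* H. Pasten, *Shimura curves and the abc conjecture*, J. Number Theory 254 (2024) 214–335 =
  arXiv:1705.09251 (held, read): §4.6 p. 15, §4.9 p. 16. [PastenShimura2024]
* M.-F. Vignéras, *Arithmétique des algèbres de quaternions*, LNM 800 (1980), Ch. IV §1
  Thm. 1.1. [VignerasLNM800]
* G. Shimura, *Introduction to the arithmetic theory of automorphic functions* (1971), §2.6.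
  [ShimuraIATAF1971]
-/

noncomputable section

open scoped MatrixGroups ModularForm Manifold Topology BoundedContinuousFunction
open UpperHalfPlane

namespace Literature.NumberTheory.Automorphic

/-! ### 1. The invariant `‖f z‖² (Im z)^k` and its global bound -/

section Invariant

variable {Γ : Subgroup (GL (Fin 2) ℝ)} [Γ.HasDetOne] {k : ℤ} {F : Type*} [FunLike F ℍ ℂ]
  [SlashInvariantFormClass F Γ k]

/-- **`Γ`-invariance of `‖f‖² yᵏ`**: for `f` slash-invariant of weight `k` under `Γ ≤ SL₂(ℝ)` and
`γ ∈ Γ`, `‖f(γz)‖² (Im γz)^k = ‖f z‖² (Im z)^k`, from `f(γz) = (cz+d)^k f(z)`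
(`SlashInvariantForm.slash_action_eqn''`) and `Im γz = Im z / |cz+d|²`. [folklore] -/
theorem norm_sq_mul_im_zpow_smul (f : F) {γ : GL (Fin 2) ℝ} (hγ : γ ∈ Γ) (z : ℍ) :
    ‖f (γ • z)‖ ^ 2 * (γ • z).im ^ k = ‖f z‖ ^ 2 * z.im ^ k := by
  have hd : denom γ z ≠ 0 := denom_ne_zero γ z
  set a : ℝ := ‖denom γ z‖ with ha
  have ha0 : 0 < a := norm_pos_iff.mpr hd
  have hN : Complex.normSq (denom γ z) = a ^ 2 := by
    rw [Complex.normSq_eq_norm_sq]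
  have hdet : |(γ.det : ℝˣ).val| = 1 := by
    rw [Subgroup.HasDetOne.det_eq hγ, Units.val_one, abs_one]
  rw [SlashInvariantForm.slash_action_eqn'' f hγ z, UpperHalfPlane.im_smul_eq_div_normSq, hdet,
    one_mul, hN, norm_mul, norm_zpow, ← ha, mul_pow, div_zpow]
  have h1 : (a ^ k) ^ 2 = (a ^ 2) ^ k := by
    rw [← zpow_natCast (a ^ k) 2, ← zpow_mul, ← zpow_natCast a 2, ← zpow_mul, mul_comm]
  rw [h1]
  have h2 : (a ^ 2) ^ k ≠ 0 := zpow_ne_zero k (pow_ne_zero 2 ha0.ne')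
  field_simp

/-- **The global bound from a compact set of representatives**: if the compact `K` meets every
`Γ`-orbit and `‖f‖ ≤ C` on `K`, then `‖f z‖² (Im z)^k ≤ A · C²` on all of `ℍ`, where
`A = (Im z_A)^k` is the maximum of `(Im ·)^k` on `K` (any `z_A ∈ K` maximising it).
[folklore] -/
theorem norm_sq_mul_im_zpow_le_of_cover {K : Set ℍ} (hcov : ∀ z : ℍ, ∃ γ ∈ Γ, γ • z ∈ K)
    {zA : ℍ} (hzA : IsMaxOn (fun z : ℍ => z.im ^ k) K zA) (f : F) {C : ℝ}
    (hC : ∀ z ∈ K, ‖f z‖ ≤ C) (z : ℍ) :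
    ‖f z‖ ^ 2 * z.im ^ k ≤ zA.im ^ k * C ^ 2 := by
  obtain ⟨γ, hγ, hγz⟩ := hcov z
  rw [← norm_sq_mul_im_zpow_smul f hγ z, mul_comm]
  have h1 : (γ • z).im ^ k ≤ zA.im ^ k := hzA hγz
  have h2 : ‖f (γ • z)‖ ^ 2 ≤ C ^ 2 :=
    pow_le_pow_left₀ (norm_nonneg _) (hC _ hγz) 2
  exact mul_le_mul h1 h2 (sq_nonneg _) (zpow_nonneg zA.im_pos.le k)

end Invariant

/-- `t ↦ tⁿ` on a compact interval of positive reals is bounded by the sum of its end values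
(it is monotone for `n ≥ 0` and antitone for `n < 0`). [folklore] -/
theorem zpow_le_add_zpow_of_mem_Icc {a b t : ℝ} (ha : 0 < a) (hat : a ≤ t) (htb : t ≤ b)
    (n : ℤ) : t ^ n ≤ a ^ n + b ^ n := by
  have ht : 0 < t := ha.trans_le hat
  have hb : 0 < b := ht.trans_le htb
  rcases le_or_gt 0 n with hn | hn
  · exact le_add_of_nonneg_of_le (zpow_nonneg ha.le n) (zpow_le_zpow_left₀ hn ht.le htb)
  · have h : t ^ n ≤ a ^ n := by
      have h1 : t⁻¹ ≤ a⁻¹ := (inv_le_inv₀ ht ha).mpr hat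
      have h2 := zpow_le_zpow_left₀ (neg_nonneg.mpr hn.le) (inv_nonneg.mpr ht.le) h1
      simpa only [inv_zpow', neg_neg] using h2
    exact le_add_of_le_of_nonneg h (zpow_nonneg hb.le n)

/-! ### 2. Riesz–Montel: finite-dimensionality from a compact set of representatives -/

section Main

variable {Γ : Subgroup (GL (Fin 2) ℝ)} [Γ.HasDetOne] {k : ℤ}

/-- **Holomorphic weight-`k` `Γ`-invariant functions span a finite-dimensional space when `Γ` has a
compact set of representatives.** Let `Γ ≤ SL₂(ℝ)`, `K ⊆ ℍ` compact with `Γ K = ℍ`, and `V` a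
`ℂ`-vector space of functions on `ℍ` (an injective linear `ι : V → (ℍ → ℂ)`) all of which are
holomorphic and slash-invariant of weight `k` under `Γ`. Then `V` is finite-dimensional.
Restriction to `K`, `Φ : V → C(K, ℂ)`, is injective (the invariant bound); the image of its unit
ball has values in the unit disc and is equicontinuous (uniform bound on a complex neighbourhood of
`K` by `norm_sq_mul_im_zpow_le_of_cover`, Cauchy's estimate for the derivative, mean value
inequality), hence is relatively compact by Arzelà–Ascoli; so the unit ball of `range Φ ≅ V` is
totally bounded and Riesz's theorem applies. [folklore] -/
theorem finiteDimensional_of_slashInvariant_of_isCompact_cover {K : Set ℍ} (hK : IsCompact K)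
    (hcov : ∀ z : ℍ, ∃ γ ∈ Γ, γ • z ∈ K) {V : Type*} [AddCommGroup V] [Module ℂ V]
    (ι : V →ₗ[ℂ] (ℍ → ℂ)) (hι : Function.Injective ι)
    (hhol : ∀ v, MDifferentiable 𝓘(ℂ) 𝓘(ℂ) (ι v))
    (hinv : ∀ v, ∀ γ ∈ Γ, (ι v) ∣[k] γ = ι v) : FiniteDimensional ℂ V := by
  classical
  -- `K` is non-empty and a compact space
  have hKne : K.Nonempty := by
    obtain ⟨γ, -, h⟩ := hcov UpperHalfPlane.I
    exact ⟨_, h⟩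
  haveI : CompactSpace K := isCompact_iff_compactSpace.mp hK
  -- extrema of `Im` and of `Im ^ k` on `K`
  obtain ⟨zm, -, hzm⟩ := hK.exists_isMinOn hKne continuous_im.continuousOn
  obtain ⟨zM, -, hzM⟩ := hK.exists_isMaxOn hKne continuous_im.continuousOn
  have hcontk : Continuous fun z : ℍ => z.im ^ k :=
    continuous_im.zpow₀ k fun z => Or.inl z.im_ne_zero
  obtain ⟨zA, -, hzA⟩ := hK.exists_isMaxOn hKne hcontk.continuousOn
  set m : ℝ := zm.im with hm_def
  set M : ℝ := zM.im with hM_def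
  set A : ℝ := zA.im ^ k with hA_def
  have hm0 : 0 < m := zm.im_pos
  have hA0 : 0 ≤ A := zpow_nonneg zA.im_pos.le k
  have hmK : ∀ z ∈ K, m ≤ z.im := fun z hz => hzm hz
  have hMK : ∀ z ∈ K, z.im ≤ M := fun z hz => hzM hz
  have hmM : m ≤ M := by
    obtain ⟨z, hz⟩ := hKne
    exact (hmK z hz).trans (hMK z hz)
  -- each `ι v` as a slash-invariant form
  let S : V → SlashInvariantForm Γ k := fun v => ⟨ι v, hinv v⟩
  have hS : ∀ v, (⇑(S v) : ℍ → ℂ) = ι v := fun v => rfl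
  -- restriction to `K`
  let Φ : V →ₗ[ℂ] (K →ᵇ ℂ) :=
    { toFun := fun v => BoundedContinuousFunction.mkOfCompact
        ⟨fun x : K => ι v x, (hhol v).continuous.comp continuous_subtype_val⟩
      map_add' := fun v w => by
        ext x
        simp
      map_smul' := fun c v => by
        ext x
        simp }
  have hΦ : ∀ v (x : K), Φ v x = ι v x := fun _ _ => rfl
  have hΦle : ∀ v (z : ℍ), z ∈ K → ‖ι v z‖ ≤ ‖Φ v‖ := fun v z hz => by
    rw [← hΦ v ⟨z, hz⟩]
    exact BoundedContinuousFunction.norm_coe_le_norm (Φ v) ⟨z, hz⟩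
  -- the global bound `‖ι v z‖² (Im z)^k ≤ A ‖Φ v‖²`
  have key : ∀ v (z : ℍ), ‖ι v z‖ ^ 2 * z.im ^ k ≤ A * ‖Φ v‖ ^ 2 := fun v z => by
    have := norm_sq_mul_im_zpow_le_of_cover hcov hzA (S v) (fun z hz => hΦle v z hz) z
    simpa only [hS] using this
  -- `Φ` is injective
  have hΦinj : Function.Injective Φ := by
    intro v w hvw
    apply hι
    have h0 : Φ (v - w) = 0 := by rw [map_sub, hvw, sub_self]
    have h1 : ι (v - w) = 0 := by
      funext z
      have h := key (v - w) z
      rw [h0, norm_zero] at h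
      have hpos : 0 < z.im ^ k := zpow_pos z.im_pos k
      have h2 : ‖ι (v - w) z‖ ^ 2 ≤ 0 := by nlinarith
      have h3 : ‖ι (v - w) z‖ = 0 := by nlinarith [norm_nonneg (ι (v - w) z)]
      simpa using h3
    rwa [map_sub, sub_eq_zero] at h1
  -- constants: `δ` (size of the complex neighbourhood), `C₀` (uniform bound there), `L` (Lipschitz)
  set δ : ℝ := m / 2 with hδ_def
  have hδ0 : 0 < δ := by positivity
  set B₀ : ℝ := A * ((m / 2) ^ (-k) + (M + m / 2) ^ (-k)) with hB₀_def
  have hB₀ : 0 ≤ B₀ := by positivity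
  set C₀ : ℝ := Real.sqrt B₀ with hC₀_def
  have hC₀ : 0 ≤ C₀ := Real.sqrt_nonneg _
  set L : ℝ := C₀ / (δ / 2) with hL_def
  have hL0 : 0 ≤ L := by positivity
  -- holomorphy on `{Im > 0}` of the extensions `G v = ι v ∘ ofComplex`
  have hdiff : ∀ v, DifferentiableOn ℂ (ι v ∘ ofComplex) {w : ℂ | 0 < w.im} := fun v =>
    UpperHalfPlane.mdifferentiable_iff.mp (hhol v)
  -- (UB) uniform bound on the strip `m/2 ≤ Im ≤ M + m/2` for `‖Φ v‖ ≤ 1`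
  have hUB : ∀ v, ‖Φ v‖ ≤ 1 → ∀ w : ℂ, m / 2 ≤ w.im → w.im ≤ M + m / 2 →
      ‖(ι v ∘ ofComplex) w‖ ≤ C₀ := by
    intro v hv w hw1 hw2
    have hw0 : 0 < w.im := by linarith
    have how : ofComplex w = ⟨w, hw0⟩ := ofComplex_apply_of_im_pos hw0
    set z : ℍ := ⟨w, hw0⟩ with hz_def
    have hzim : z.im = w.im := rfl
    have hkey := key v z
    have hpos : 0 < z.im ^ k := zpow_pos z.im_pos k
    -- `‖ι v z‖² ≤ A ‖Φ v‖² / (Im z)^k ≤ A (Im z)^(-k) ≤ B₀`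
    have h1 : ‖ι v z‖ ^ 2 ≤ A * z.im ^ (-k) := by
      rw [zpow_neg, ← div_eq_mul_inv, le_div_iff₀ hpos]
      calc ‖ι v z‖ ^ 2 * z.im ^ k ≤ A * ‖Φ v‖ ^ 2 := hkey
        _ ≤ A * 1 := by
          refine mul_le_mul_of_nonneg_left ?_ hA0
          have := pow_le_pow_left₀ (norm_nonneg _) hv 2
          simpa using this
        _ = A := mul_one A
    have h2 : z.im ^ (-k) ≤ (m / 2) ^ (-k) + (M + m / 2) ^ (-k) :=
      zpow_le_add_zpow_of_mem_Icc (by positivity) (hzim ▸ hw1) (hzim ▸ hw2) (-k)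
    have h3 : ‖ι v z‖ ^ 2 ≤ B₀ := h1.trans (mul_le_mul_of_nonneg_left h2 hA0)
    have h4 : ‖ι v z‖ ≤ C₀ := by
      rw [hC₀_def, ← Real.sqrt_sq (norm_nonneg (ι v z))]
      exact Real.sqrt_le_sqrt h3
    simpa only [Function.comp_apply, how] using h4
  -- (DB) derivative bound on the ball of radius `δ/2` about a point of `K`, for `‖Φ v‖ ≤ 1`
  have hDB : ∀ v, ‖Φ v‖ ≤ 1 → ∀ x₀ : ℍ, x₀ ∈ K → ∀ y ∈ Metric.ball (x₀ : ℂ) (δ / 2),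
      ‖deriv (ι v ∘ ofComplex) y‖ ≤ L := by
    intro v hv x₀ hx₀ y hy
    rw [Metric.mem_ball] at hy
    have hx₀m : m ≤ x₀.im := hmK x₀ hx₀
    have hx₀M : x₀.im ≤ M := hMK x₀ hx₀
    -- the closed disc of radius `δ/2` about `y` lies in the strip and in `{Im > 0}`
    have hstrip : ∀ w ∈ Metric.closedBall y (δ / 2), m / 2 ≤ w.im ∧ w.im ≤ M + m / 2 := by
      intro w hw
      rw [Metric.mem_closedBall] at hw
      have hwx : dist w (x₀ : ℂ) < δ := by
        calc dist w (x₀ : ℂ) ≤ dist w y + dist y (x₀ : ℂ) := dist_triangle _ _ _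
          _ < δ / 2 + δ / 2 := add_lt_add_of_le_of_lt hw hy
          _ = δ := by ring
      rw [dist_eq_norm] at hwx
      have him : |(w - (x₀ : ℂ)).im| < δ := (Complex.abs_im_le_norm _).trans_lt hwx
      rw [Complex.sub_im, UpperHalfPlane.coe_im, abs_lt] at him
      constructor <;> [skip; skip] <;> simp only [hδ_def] at him ⊢ <;> linarith [him.1, him.2]
    have hsub : Metric.closedBall y (δ / 2) ⊆ {w : ℂ | 0 < w.im} := fun w hw => by
      have := (hstrip w hw).1
      show 0 < w.im
      linarith
    have hdc : DiffContOnCl ℂ (ι v ∘ ofComplex) (Metric.ball y (δ / 2)) :=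
      (hdiff v).diffContOnCl_ball hsub
    have hsph : ∀ w ∈ Metric.sphere y (δ / 2), ‖(ι v ∘ ofComplex) w‖ ≤ C₀ := fun w hw =>
      hUB v hv w (hstrip w (Metric.sphere_subset_closedBall hw)).1
        (hstrip w (Metric.sphere_subset_closedBall hw)).2
    exact Complex.norm_deriv_le_of_forall_mem_sphere_norm_le (by positivity) hdc hsph
  -- (LIP) uniform Lipschitz bound near each point of `K`, for `‖Φ v‖ ≤ 1`
  have hLIP : ∀ v, ‖Φ v‖ ≤ 1 → ∀ x₀ : ℍ, x₀ ∈ K → ∀ x : ℍ,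
      dist (x : ℂ) (x₀ : ℂ) < δ / 2 → ‖ι v x - ι v x₀‖ ≤ L * ‖(x : ℂ) - (x₀ : ℂ)‖ := by
    intro v hv x₀ hx₀ x hx
    have hball : Metric.ball (x₀ : ℂ) (δ / 2) ⊆ {w : ℂ | 0 < w.im} := fun w hw => by
      rw [Metric.mem_ball, dist_eq_norm] at hw
      have him : |(w - (x₀ : ℂ)).im| < δ / 2 := (Complex.abs_im_le_norm _).trans_lt hw
      rw [Complex.sub_im, UpperHalfPlane.coe_im, abs_lt] at him
      have hx₀m : m ≤ x₀.im := hmK x₀ hx₀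
      show 0 < w.im
      simp only [hδ_def] at him
      linarith [him.1]
    have hda : ∀ w ∈ Metric.ball (x₀ : ℂ) (δ / 2), DifferentiableAt ℂ (ι v ∘ ofComplex) w :=
      fun w hw => (hdiff v).differentiableAt (isOpen_upperHalfPlaneSet.mem_nhds (hball hw))
    have h := Convex.norm_image_sub_le_of_norm_deriv_le hda (hDB v hv x₀ hx₀)
      (convex_ball (x₀ : ℂ) (δ / 2)) (Metric.mem_ball_self (by positivity)) hx
    simpa only [Function.comp_apply, ofComplex_apply] using h
  -- the image of the unit ball: values in the unit disc, equicontinuous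
  set T : Set (K →ᵇ ℂ) := {φ | ∃ v, Φ v = φ ∧ ‖φ‖ ≤ 1} with hT_def
  have hin : ∀ (φ : K →ᵇ ℂ) (x : K), φ ∈ T → φ x ∈ Metric.closedBall (0 : ℂ) 1 := by
    rintro φ x ⟨v, rfl, hv⟩
    rw [mem_closedBall_zero_iff]
    exact (BoundedContinuousFunction.norm_coe_le_norm (Φ v) x).trans hv
  have hequi : Equicontinuous ((↑) : T → K → ℂ) := by
    intro x₀
    rw [Metric.equicontinuousAt_iff_right]
    intro ε hε
    set r : ℝ := min (δ / 2) (ε / (2 * (L + 1))) with hr_def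
    have hr0 : 0 < r := lt_min (by positivity) (by positivity)
    have hc : Continuous fun x : K => ((x : ℍ) : ℂ) := continuous_coe.comp continuous_subtype_val
    have hU : (fun x : K => ((x : ℍ) : ℂ)) ⁻¹' Metric.ball ((x₀ : ℍ) : ℂ) r ∈ 𝓝 x₀ :=
      (Metric.isOpen_ball.preimage hc).mem_nhds (Metric.mem_ball_self hr0)
    filter_upwards [hU] with x hx
    rintro ⟨φ, v, rfl, hv⟩
    have hx' : dist ((x : ℍ) : ℂ) ((x₀ : ℍ) : ℂ) < r := hx
    have h1 : ‖ι v x - ι v x₀‖ ≤ L * ‖((x : ℍ) : ℂ) - ((x₀ : ℍ) : ℂ)‖ :=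
      hLIP v hv x₀ x₀.2 x (hx'.trans_le (min_le_left _ _))
    have h2 : L * ‖((x : ℍ) : ℂ) - ((x₀ : ℍ) : ℂ)‖ < ε := by
      rw [← dist_eq_norm]
      have h3 : L * dist ((x : ℍ) : ℂ) ((x₀ : ℍ) : ℂ) ≤ L * (ε / (2 * (L + 1))) :=
        mul_le_mul_of_nonneg_left (hx'.le.trans (min_le_right _ _)) hL0
      have h4 : L * (ε / (2 * (L + 1))) < ε := by
        rw [mul_div_assoc']
        rw [div_lt_iff₀ (by positivity)]
        nlinarith
      exact h3.trans_lt h4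
    show dist (Φ v x₀) (Φ v x) < ε
    rw [dist_comm, dist_eq_norm, hΦ, hΦ]
    exact h1.trans_lt h2
  have hcpt : IsCompact (closure T) :=
    BoundedContinuousFunction.arzela_ascoli (Metric.closedBall (0 : ℂ) 1)
      (isCompact_closedBall 0 1) T hin hequi
  -- Riesz: the unit ball of `range Φ` is totally bounded
  haveI : FiniteDimensional ℂ (LinearMap.range Φ) := by
    refine FiniteDimensional.of_totallyBounded_nhds_zero ℂ
      (Metric.closedBall_mem_nhds (0 : LinearMap.range Φ) one_pos) ?_
    have hpre : ((↑) : LinearMap.range Φ → (K →ᵇ ℂ)) ⁻¹' T =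
        Metric.closedBall (0 : LinearMap.range Φ) 1 := by
      ext ⟨φ, hφ⟩
      obtain ⟨v, rfl⟩ := LinearMap.mem_range.mp hφ
      simp only [Set.mem_preimage, hT_def, Set.mem_setOf_eq, Metric.mem_closedBall, dist_zero_right,
        Submodule.coe_norm]
      exact ⟨fun ⟨_, _, h⟩ => h, fun h => ⟨v, rfl, h⟩⟩
    rw [← hpre]
    exact totallyBounded_preimage isometry_subtype_coe.isUniformInducing
      (hcpt.totallyBounded.subset subset_closure)
  exact LinearEquiv.finiteDimensional (LinearEquiv.ofInjective Φ hΦinj).symm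

/-- **`M_k(Γ)` is finite-dimensional** for `Γ ≤ SL₂(ℝ)` with a compact set of representatives.
[folklore] -/
theorem finiteDimensional_modularForm_of_isCompact_cover {K : Set ℍ} (hK : IsCompact K)
    (hcov : ∀ z : ℍ, ∃ γ ∈ Γ, γ • z ∈ K) (k : ℤ) : FiniteDimensional ℂ (ModularForm Γ k) :=
  finiteDimensional_of_slashInvariant_of_isCompact_cover (k := k) hK hcov
    { toFun := fun f => ⇑f
      map_add' := fun f g => ModularForm.coe_add f g
      map_smul' := fun c f => ModularForm.IsGLPos.coe_smul f c }
    (fun _ _ h => DFunLike.coe_injective h) (fun f => f.holo')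
    (fun f γ hγ => SlashInvariantForm.slash_action_eqn f γ hγ)

/-- **`S_k(Γ)` is finite-dimensional** for `Γ ≤ SL₂(ℝ)` with a compact set of representatives.
[folklore] -/
theorem finiteDimensional_cuspForm_of_isCompact_cover {K : Set ℍ} (hK : IsCompact K)
    (hcov : ∀ z : ℍ, ∃ γ ∈ Γ, γ • z ∈ K) (k : ℤ) : FiniteDimensional ℂ (CuspForm Γ k) :=
  finiteDimensional_of_slashInvariant_of_isCompact_cover (k := k) hK hcov
    { toFun := fun f => ⇑f
      map_add' := fun f g => CuspForm.coe_add f g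
      map_smul' := fun c f => CuspForm.IsGLPos.coe_smul f c }
    (fun _ _ h => DFunLike.coe_injective h) (fun f => f.holo')
    (fun f γ hγ => SlashInvariantForm.slash_action_eqn f γ hγ)

end Main

/-! ### 3. `S_k(Γ₀^D(M))` and `M_k(Γ₀^D(M))` for `D > 1` -/

namespace ShimuraCurveData

variable {D M : ℕ} (X : ShimuraCurveData D M)

/-- A compact set of representatives for `Γ₀^D(M)` acting on `ℍ`, `D > 1`: a closed hyperbolic
ball (the tree's `exists_forall_exists_smul_mem_closedBall`, Vignéras IV Thm. 1.1; `ℍ` is a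
proper metric space). [cite: VignerasLNM800, Ch. IV §1 Thm. 1.1] -/
theorem exists_isCompact_cover (hD : 1 < D) :
    ∃ K : Set ℍ, IsCompact K ∧ ∀ z : ℍ, ∃ γ ∈ X.Gamma, γ • z ∈ K := by
  obtain ⟨ρ, hρ⟩ := X.exists_forall_exists_smul_mem_closedBall hD
  exact ⟨Metric.closedBall UpperHalfPlane.I ρ, isCompact_closedBall _ _, hρ⟩

/-- **`S_k(Γ₀^D(M))` is finite-dimensional for `D > 1`** (every weight `k`) — in particular
`S₂^D(M) = CuspForm X.Gamma 2`, Pasten's `S_{U₀^D(M)}` (§4.6: "`dim S_{U,a} = g_U`"; only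
finiteness is asserted here). [cite: PastenShimura2024, §4.6 p. 15] -/
theorem finiteDimensional_cuspForm (hD : 1 < D) (k : ℤ) :
    FiniteDimensional ℂ (CuspForm X.Gamma k) := by
  obtain ⟨K, hK, hcov⟩ := X.exists_isCompact_cover hD
  exact finiteDimensional_cuspForm_of_isCompact_cover hK hcov k

/-- **`M_k(Γ₀^D(M))` is finite-dimensional for `D > 1`** (every weight `k`). [cite: PastenShimura2024, §4.6 p. 15] -/
theorem finiteDimensional_modularForm (hD : 1 < D) (k : ℤ) :
    FiniteDimensional ℂ (ModularForm X.Gamma k) := by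
  obtain ⟨K, hK, hcov⟩ := X.exists_isCompact_cover hD
  exact finiteDimensional_modularForm_of_isCompact_cover hK hcov k

end ShimuraCurveData

end Literature.NumberTheory.Automorphic

end
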